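import Summits.AtomisticToContinuum.Crystallization.Theorems.OverbindingBudgetAffineFarSmoothSeam

/-!
# OverbindingBudget — the FAR tail transfer Z3‴ split: coherent DRIFT (Z3a) + INFLOW WALL LAW on the sheltered class (Z3b‴), with the PROVED glue
# (decomp-a2c lens-4, generation 48 = v7 of the generation-47 split; critic row 775: the class is the SHELTERED normal far class, for every shelter radius)

Sequel of `…OverbindingBudgetAffineFarSmoothSeam` (v7).  Complete proofs, no new instance/notation.  Z3‴ `ShelteredTailTransferInf θ θ₀` bounds, for
the sheltered normal far class `Sh_R = shelteredFarSet R θ₀ 12 ε₁ θ δ y` (every `R ≥ 0`), `Σ_{i∈Sh_R} (tailInf θ (F i) − smoothTail G y i) ≤ C_T(δ)·#Gᶜ +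
C'·ε₁·#Sh_R`.  This file cuts it along a MATCHING of the good matter in each row's tail zone to the structure points of a continuation of the row's chart:
* `matchTol D ε₁ nn r := min (D·ε₁·nn·(1 + (r/nn)²)) (nn/4)` — the quadratic DRIFT tolerance (second differences of an everywhere-`AffReg` deformation are
  `≤ 2ε₁·nn` per step, so smooth drift at distance `r` is `≲ ε₁ r²/nn`), CAPPED at `nn/4` so matched sites stay lattice-like at every distance.
* `Matched D ε₁ y i c M π`: `π` maps the finset `M` injectively to structure points of the chart `c`, each `k ∈ M` within `matchTol` of `y i + a₀·B(π k)`.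
* Z3a `TailDriftBound θ θ₀` (byte-identical to generation 47 · TRUE-type · ATTACKABLE-S/M): for a NORMAL far site (sheltered or not), an admissible chart
  with `|c.nn − nn_i| ≤ Cε₁·nn_i` and ANY matching, `refTail c − smoothTail M y i ≤ C''·ε₁` — unmatched STRUCTURE points are free (`V ≤ 0` on the tail
  support since `nn_i ≥ 0.95648` on `Fn`), matched pairs differ by `Lip(tailW·V)(r)·matchTol ≲ r⁻⁷·ε₁r²/nn` summed over lattice-like shells, the capped
  far part is `O(ε₁²)`.  `C''` is `δ`-free and `N`-free.
* Z3b‴ `ShelteredInflowWallLaw θ θ₀` (v7 · TRUE-type on paper · ATTACKABLE-L — the load-bearing half): `∀ C ≥ 0 ∀ R ≥ 0 ∃ D, C''', ε_W ∀ ε₁ ≤ ε_W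
  ∀ δ ∃ C_T ∀ N y F` (admissible `Cε₁`-exact charts on `Sh_R`) `∃` continuations `F'`, matchings `(M i ⊆ G, π i)` with `Σ_{i∈Sh_R} −smoothTail (G ∖ M i) y i
  ≤ C_T·#Gᶜ + C'''·ε₁·#Sh_R`: the tail attraction flowing into sheltered normal far rows from UNMATCHED good matter is paid by walls (`C_T` after `δ`:
  films `C_T ≍ 2.2·10⁻⁵/δ`; funnels terminate in walls; a second h-plane family beyond the chart ball forces a crossing/termination defect within
  `≈ (D + 9)/sin(α/2)` — regime (f) of the Split's doc) plus the drift overflow beyond the cap radius (`∝ ε₁^{3/2} ≤ C'''ε₁`).  No reference energies, no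
  `tailInf`, no Barlow sums.  `R = 0` is generation 47's `InflowWallLaw` verbatim.  Might fail: a wall-free `AffReg` texture whose unmatched inflow is
  volume-like (excluded on paper only through quasiconformal rigidity).
* GLUE (PROVED): `θ ≤ 1/18 → TailDriftBound θ θ₀ → ShelteredInflowWallLaw θ θ₀ → ShelteredTailTransferInf θ θ₀` (`tailInf ≤ refTail (F' i)` by
  `tailInf_le_refTail_of_continues`; `smoothTail G = smoothTail (M i) + smoothTail (G ∖ M i)`; `C' := C'' + C'''`, `ε_B := min ε_D ε_W`), and the record
  corollary at `(θ, θ₀) = (1/25, 1/2000)`.  Neither piece gives Z3‴ alone (probes).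
-/

namespace Summit.AtomisticToContinuum.Crystallization.Theorems.OverbindingBudgetAffineFarSmoothSplit

open scoped BigOperators Classical
open Literature.MathematicalPhysics.StatisticalMechanics
open Literature.Geometry.DiscreteGeometry (nearestDist nearestDist_nonneg fccTwoShellPattern hcpTwoShellPattern)
open Summit.AtomisticToContinuum.Crystallization.Theorems.OverbindingBudgetBalancedCensusStatements
open Summit.AtomisticToContinuum.Crystallization.Theorems.OverbindingBudgetAffineLadder
open Summit.AtomisticToContinuum.Crystallization.Theorems.OverbindingBudgetAffineLocalisation

variable {N : ℕ}

local notation "E3" => EuclideanSpace ℝ (Fin 3)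

/-! ## §1  Matchings of good matter to a chart's structure -/

/-- The matching tolerance at distance `r` from a site of nearest distance `nn`: quadratic drift `D·ε₁·nn·(1 + (r/nn)²)`, capped at `nn/4`. -/
noncomputable def matchTol (D ε₁ nn r : ℝ) : ℝ := min (D * ε₁ * nn * (1 + (r / nn) ^ 2)) (nn / 4)

/-- The cap: `matchTol ≤ nn/4`. [this file] -/
theorem matchTol_le_quarter (D ε₁ nn r : ℝ) : matchTol D ε₁ nn r ≤ nn / 4 := min_le_right _ _

/-- `Matched D ε₁ y i c M π`: `π` maps `M` injectively to structure points of the chart `c` (Literature `barlowStacking 1 √(2/3) c.s`), and every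
`k ∈ M` lies within `matchTol D ε₁ nn_i r_ik` of its point `y i + a₀ · B (π k)`. -/
def Matched (D ε₁ : ℝ) (y : Fin N → E3) (i : Fin N) (c : Chart) (M : Finset (Fin N)) (π : Fin N → E3) : Prop :=
  Set.InjOn π ↑M ∧ ∀ k ∈ M, π k ∈ barlowStacking 1 (Real.sqrt (2 / 3)) c.s ∧
    dist (y k) (y i + c.a₀ • c.B (π k)) ≤ matchTol D ε₁ (nearestDist y i) (dist (y i) (y k))

/-- The empty matching. [this file] -/
theorem matched_empty (D ε₁ : ℝ) (y : Fin N → E3) (i : Fin N) (c : Chart) (π : Fin N → E3) : Matched D ε₁ y i c ∅ π :=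
  ⟨by simp [Set.InjOn], fun k hk => by simp at hk⟩

/-- Splitting a smooth tail along a sub-class: `smoothTail G = smoothTail M + smoothTail (G ∖ M)` for `M ⊆ G`. [this file] -/
theorem smoothTail_eq_add_sdiff {M G : Finset (Fin N)} (h : M ⊆ G) (y : Fin N → E3) (i : Fin N) :
    smoothTail G y i = smoothTail M y i + smoothTail (G \ M) y i := by
  unfold smoothTail; rw [← mul_add, add_comm, Finset.sum_sdiff h]

/-! ## §2  The two pieces -/

/-- **Z3a · `TailDriftBound θ θ₀`** (NEW · TRUE-type · ATTACKABLE-S/M): R_aff ⇒ for all constants `C, D ≥ 0` there are `C'' ≥ 0`, `ε_D > 0` such that for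
`ε₁ ≤ ε_D`, every window, every injective configuration, every NORMAL far site `i` (far, not scale-bad), every `θ`-admissible chart `c` with
`|c.nn − nn_i| ≤ C·ε₁·nn_i` and every matching `(M, π)`: `refTail c − smoothTail M y i ≤ C''·ε₁`.  (Unmatched structure points are free: `V ≤ 0` on the
tail support because `nn_i ≥ 0.95648` on `Fn`; matched pairs: Lipschitz of `tailW·V` times `matchTol`, lattice-like shell counts by injectivity and the cap.)
Might fail: only by mis-typing — the scale floor of `Fn` (`G` sites are charge-free, `i ∉ sb` ⇒ `¬Short`/`RT`) must be derived inside the proof. -/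
def TailDriftBound (θ θ₀ : ℝ) : Prop :=
  AffineChartStraightening → ∀ C : ℝ, 0 ≤ C → ∀ D : ℝ, 0 ≤ D → ∃ C'' εD : ℝ, 0 ≤ C'' ∧ 0 < εD ∧
    ∀ ε₁ : ℝ, 0 < ε₁ → ε₁ ≤ εD → ∀ δ : ℝ, 0 < δ → δ ≤ 2 → ∀ (N : ℕ) (y : Fin N → E3), Function.Injective y →
      ∀ i ∈ farSet θ₀ 12 ε₁ θ δ y, i ∉ goodScaleBadSet 12 ε₁ θ δ y → ∀ c : Chart, ChartAdmissible θ c →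
        |c.nn - nearestDist y i| ≤ C * ε₁ * nearestDist y i →
          ∀ (M : Finset (Fin N)) (π : Fin N → E3), Matched D ε₁ y i c M π → refTail c - smoothTail M y i ≤ C'' * ε₁

/-- **Z3b‴ · `ShelteredInflowWallLaw θ θ₀`** (v7 · TRUE-type on paper · ATTACKABLE-L; the load-bearing half of Z3‴): R_aff ⇒ `∀ C ≥ 0 ∀ R ≥ 0 ∃ D,
C''' ≥ 0, ε_W > 0 ∀ ε₁ ≤ ε_W ∀ δ ∈ (0,2] ∃ C_T ≥ 0 ∀ N y F` (admissible `Cε₁`-exact charts on `Sh_R`): there are continuations `F'`, sub-classes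
`M i ⊆ G` and matchings `π i` (`Matched D ε₁ y i (F' i) (M i) (π i)`) with `Σ_{i∈Sh_R} −smoothTail (G ∖ M i) y i ≤ C_T·#Gᶜ + C'''·ε₁·#Sh_R` — the tail
attraction of UNMATCHED good matter into the sheltered normal far rows is paid by walls (`C_T` after `δ`) and an `O(ε₁)` per-site drift overflow.
Might fail: a wall-free everywhere-`AffReg` texture with volume-like unmatched inflow (excluded on paper by quasiconformal rigidity and the `nn ≥ δ`
floor: funnels terminate in walls; films: `C_T ≍ 2.2·10⁻⁵/δ`; foreign h-plane families: crossing defects, regime (f)). -/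
def ShelteredInflowWallLaw (θ θ₀ : ℝ) : Prop :=
  AffineChartStraightening → ∀ C : ℝ, 0 ≤ C → ∀ R : ℝ, 0 ≤ R → ∃ D C''' εW : ℝ, 0 ≤ D ∧ 0 ≤ C''' ∧ 0 < εW ∧
    ∀ ε₁ : ℝ, 0 < ε₁ → ε₁ ≤ εW → ∀ δ : ℝ, 0 < δ → δ ≤ 2 → ∃ CT : ℝ, 0 ≤ CT ∧
      ∀ (N : ℕ) (y : Fin N → E3), Function.Injective y → ∀ F : Fin N → Chart,
        (∀ i ∈ shelteredFarSet R θ₀ 12 ε₁ θ δ y, IsChart C ε₁ y i (F i) ∧ ChartAdmissible θ (F i)) →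
          ∃ (F' : Fin N → Chart) (M : Fin N → Finset (Fin N)) (π : Fin N → Fin N → E3),
            (∀ i ∈ shelteredFarSet R θ₀ 12 ε₁ θ δ y,
              Continues θ (F i) (F' i) ∧ M i ⊆ goodSet 12 ε₁ θ δ y ∧ Matched D ε₁ y i (F' i) (M i) (π i)) ∧
            ∑ i ∈ shelteredFarSet R θ₀ 12 ε₁ θ δ y, -smoothTail (goodSet 12 ε₁ θ δ y \ M i) y i
              ≤ CT * (((goodSet 12 ε₁ θ δ y)ᶜ).card : ℝ) + C''' * ε₁ * ((shelteredFarSet R θ₀ 12 ε₁ θ δ y).card : ℝ)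

/-! ## §3  The glue (PROVED) -/

/-- **Z3a → Z3b‴ → Z3‴** (`θ ≤ 1/18` for the continuation infimum to be a genuine infimum). [this file] -/
theorem shelteredTailTransferInf_of_drift_wall {θ θ₀ : ℝ} (hθ : θ ≤ 1 / 18) (ha : TailDriftBound θ θ₀) (hb : ShelteredInflowWallLaw θ θ₀) :
    ShelteredTailTransferInf θ θ₀ := by
  intro hR C hC R hR0
  obtain ⟨D, C''', εW, hD, hC''', hεW, hW⟩ := hb hR C hC R hR0
  obtain ⟨C'', εD, hC'', hεD, hA⟩ := ha hR C hC D hD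
  refine ⟨C'' + C''', min εD εW, add_nonneg hC'' hC''', lt_min hεD hεW, fun ε₁ hε₁ hε₁le δ hδ hδ2 => ?_⟩
  have hεD' : ε₁ ≤ εD := hε₁le.trans (min_le_left _ _)
  have hεW' : ε₁ ≤ εW := hε₁le.trans (min_le_right _ _)
  obtain ⟨CT, hCT, hW'⟩ := hW ε₁ hε₁ hεW' δ hδ hδ2
  refine ⟨CT, hCT, fun N y hy F hF => ?_⟩
  obtain ⟨F', M, π, hsel, hsum⟩ := hW' N y hy F hF
  set G := goodSet 12 ε₁ θ δ y
  set Sh := shelteredFarSet R θ₀ 12 ε₁ θ δ y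
  have hterm : ∀ i ∈ Sh, tailInf θ (F i) - smoothTail G y i ≤ C'' * ε₁ + -smoothTail (G \ M i) y i := by
    intro i hi
    have hi12 := (mem_shelteredFarSet.mp hi).1
    obtain ⟨hcont, hMG, hmatch⟩ := hsel i hi
    have hch := hF i hi
    have hnn : |(F' i).nn - nearestDist y i| ≤ C * ε₁ * nearestDist y i := by rw [hcont.2.2.2.1]; exact hch.1.1
    have h1 : tailInf θ (F i) ≤ refTail (F' i) := tailInf_le_refTail_of_continues hθ hcont
    have h2 : refTail (F' i) - smoothTail (M i) y i ≤ C'' * ε₁ :=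
      hA ε₁ hε₁ hεD' δ hδ hδ2 N y hy i hi12.1 hi12.2 (F' i) hcont.1 hnn (M i) (π i) hmatch
    have h3 : smoothTail G y i = smoothTail (M i) y i + smoothTail (G \ M i) y i := smoothTail_eq_add_sdiff hMG y i
    linarith
  have hsumle : ∑ i ∈ Sh, (tailInf θ (F i) - smoothTail G y i) ≤ ∑ i ∈ Sh, (C'' * ε₁ + -smoothTail (G \ M i) y i) :=
    Finset.sum_le_sum hterm
  have hsplit : ∑ i ∈ Sh, (C'' * ε₁ + -smoothTail (G \ M i) y i)
      = (Sh.card : ℝ) * (C'' * ε₁) + ∑ i ∈ Sh, -smoothTail (G \ M i) y i := by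
    rw [Finset.sum_add_distrib, Finset.sum_const, nsmul_eq_mul]
  have hSh0 : (0 : ℝ) ≤ (Sh.card : ℝ) := Nat.cast_nonneg _
  show ∑ i ∈ Sh, (tailInf θ (F i) - smoothTail G y i) ≤ CT * ((Gᶜ.card : ℕ) : ℝ) + (C'' + C''') * ε₁ * (Sh.card : ℝ)
  nlinarith [hsumle, hsplit, hsum, hSh0]

/-- **The split at the literals of record**: Z3a and Z3b‴ at `(θ, θ₀) = (1/25, 1/2000)` give Z3‴ `ShelteredTailTransferInf (1/25) (1/2000)`. [this file] -/
theorem shelteredTailTransferInf_record_of_drift_wall (ha : TailDriftBound (1 / 25) (1 / 2000))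
    (hb : ShelteredInflowWallLaw (1 / 25) (1 / 2000)) : ShelteredTailTransferInf (1 / 25) (1 / 2000) :=
  shelteredTailTransferInf_of_drift_wall (by norm_num) ha hb

end Summit.AtomisticToContinuum.Crystallization.Theorems.OverbindingBudgetAffineFarSmoothSplit
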